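import Summits.QuantumFields.BalabanUV.T4Continuum.Spine.NE1p.DressedSuppliedBoxWitness
import Summits.QuantumFields.BalabanUV.T4Continuum.Spine.NE1p.DressedPositionalCount

/-!
# T⁴ programme, spine estimate NE1′ (node O3b/H2) — THE MET COMPONENT IS A BOX, PART 2: S4 §3's `card_le_of_center_box` ∕
# `count_of_anchoring_box` FIRE on PART 1's datum `towerX` (their first appliers), row S3u §2's supplied END fires with the component
# volume `v = vR = 16`, and the GENUINENESS records (volume and live count ATTAINED, the window TIGHT, W37's absorption weight REFUSED)
# (crew row W49 ∕ DAG N29zzq, PART 2; INTENT HOME/CLAIMS.log 2026-08-20 l.19370, STAGED l.19531, BOOKED typer R-T125 l.19575; X-read X162)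

Cell `pub-balaban`, sub-cell `t4`, BINDER-OWNERS row NE1′, crew `b2b-balaban-t4-ne1p-formalise-*`, seat `leaf-02` (gen 14).  ADDITIVE —
imports PART 1 `Spine/NE1p/DressedSuppliedBoxWitness` (the datum + S3u §2's function-level binders; → W42.1 → W37.1 → W32 → row S3u) and
row S4 `Spine/NE1p/DressedPositionalCount` (p212703∕p217029: `card_le_of_center_box`, `count_of_anchoring_box` BY NAME) ONLY; THEOREMS
ONLY (0 `def`); nothing of S3u ∕ S3i ∕ S4 ∕ S5e ∕ W14 ∕ W20 ∕ W32 ∕ W37 ∕ W42 is restated.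
* §3 the supplier data on `towerX`: multiplicity `mB = 1` by W14's `coords_injective`; `center_inj` + `hbox` (centres in `{0,1}⁴`) ⇒
  **`comp_card_le_box`** = S4 §3 `card_le_of_center_box` at `ℓ = 2` (its FIRST applier) ⇒ `hvol` at `v = 16`; **`count_box_fires`** = S4 §3
  `count_of_anchoring_box` (its FIRST applier); housing (the new-born at their own cubes, the old at the corner); `CompVol 16`; the seam
  and the absorption law as EQUALITIES (nothing absorbed: `4·gen = βX`); `hβ` with equality at `β₀ = 1∕32`; the window at
  `(A, vR·mB, ρ′) = (1∕64, 16, ½)`: `fanout = ½`, `absorbAmplitude = 1∕16 = A₀` — TIGHT.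
* §4 **`suppliedBox_fires`**: S3u §2's `dressedStabilityStrict_of_suppliedComposition` ONCE BY NAME at `N₀ = 16`, `A₀ = 1∕16`, `v = vR = 16`,
  `mB = 1` (+ the headline and ROOT-B as `example`s — closed-statement dedup etiquette); `positionalCount_X` at `N j k = 16·(2⁴)^(k−j)`.
* §5 GENUINENESS: `comp_card_eq` (= 16, `hvol` ATTAINED), `not_compVol_fifteen`, `live_count_top_eq` (S3i's count `N₀·Λ^(k−j)` ATTAINED at
  `j = k` BY THE VOLUME), `window_tight`, **`w37_weight_refused`** (`¬ fanout ⅛ 16 ½ < 1`: at box volume W37's absorption weight is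
  barred by the window — the located DESIGN CONSTRAINT for a box datum WITH absorption: `A < 1∕32`).

WORDING OF RECORD (typer R-T125 (iii): title + rider — leaf-10 l.19505's wish adopted): «THE MET COMPONENT IS A BOX — S4 §3's
`card_le_of_center_box` ∕ `count_of_anchoring_box` FIRE, `CompVol 16` ATTAINED» + RIDER «`ℓ = 2`, `lo = 0`, `v = 16` are OUR toy numerals (the
skeleton's R4 numeral `ℓ` stays a DISPLAYED binder); S4's `card_le_of_center_box` ∕ `count_of_anchoring_box` are applied BY NAME with
`hbox`∕`hinj` discharged by W14's `coords_injective`» — here: `hbox_X` (centres in `{0,1}⁴`), `center_inj_X` (the `hinj`∕`center_inj` binder, by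
`coords_injective` + `Fin.ext`), `comp_card_le_box`, `count_box_fires`.

HONEST FRAMING (c4).  As PART 1: a decided (γ)-side toy over the crew's SHAPES; SOCKET COMPOSITION certified with the component-volume
binders load-bearing, NOT that met components ∕ ℝ-operations of [Balaban1989LargeFieldII] were constructed or bounded; the skeleton's R4
numeral `ℓ` stays a DISPLAYED binder (the toy's `ℓ = 2` is OURS, no numeral of print); discharges no wall item; wall v1.7 does NOT move;
R-t4r2-Q2 NOT met; NE1′ NOT printed, NOT proved; spine PROVED 0∕9; count 9 unchanged.  [decided toy] ∕ [folklore]; 0 `def … : Prop`; 0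
citations.  Rung (B)+1 on ONE finite four-torus — NOT infinite volume, NOT a mass gap, NOT OS on ℝ⁴, NOT Clay.  HONEST DEPENDENCY:
continuum YM on T⁴ ⇐ BetaPertH ∧ nine spine estimates (0/9 proved); BetaPertH ⇐ (D1) ∧ (D4) ∧ CAP+tail; G-an2-4 gates asym, D1 and NE2/3/4.
-/

noncomputable section

namespace Summit.QuantumFields.BalabanUV.T4Continuum.NE1p.DressedSuppliedBoxWitnessEnd

open Set Metric Finset
open scoped BigOperators
open Literature.MathematicalPhysics.QuantumFieldTheory.Balaban1983to89
open Literature.MathematicalPhysics.QuantumFieldTheory.Balaban1983to89.T4TermFormat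
open Literature.MathematicalPhysics.QuantumFieldTheory.Balaban1983to89.T4FeltGeometry
open Literature.MathematicalPhysics.QuantumFieldTheory.Balaban1983to89.T4TrajectoryComparison
open Literature.MathematicalPhysics.QuantumFieldTheory.Balaban1983to89.T4BirthChartTransport (GaugeInvariant BirthSlice RelGauge)
open Literature.MathematicalPhysics.QuantumFieldTheory.Balaban1983to89.T4PreservedUnderR (RStep)
open Summit.QuantumFields.BalabanUV.T4Continuum.T4TrajectoryDensityDressed
open Summit.QuantumFields.BalabanUV.T4Continuum.NE1p.DressedRoot
open Summit.QuantumFields.BalabanUV.T4Continuum.NE1p.DressedUniformConstants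
open Summit.QuantumFields.BalabanUV.T4Continuum.NE1p.DressedAbsorptionWindow
open Summit.QuantumFields.BalabanUV.T4Continuum.NE1p.DressedRootComposition
open Summit.QuantumFields.BalabanUV.T4Continuum.NE1p.DressedStabilityStrictOfSuppliedComposition
open Summit.QuantumFields.BalabanUV.T4Continuum.NE1p.DressedPositionalCount (card_le_of_center_box count_of_anchoring_box)
open Summit.QuantumFields.BalabanUV.T4Continuum.NE1p.DressedValueMapWitness (vmap norm_vmap vmap_affine theta_pow_le_one)
open Summit.QuantumFields.BalabanUV.T4Continuum.NE1p.DressedTowerWitnessBlocks (Blk coords coords_injective coarsen_coords_zero coarsen_coords_succ)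
open Summit.QuantumFields.BalabanUV.T4Continuum.NE1p.DressedSuppliedBoxWitness

/-! ## §3 The supplier data: multiplicity, THE BOX COUNT (S4 §3 fired), housing, the ℝ-step with the box as its component -/

/-- `hmult`: per-block multiplicity `mB = 1` — a family is its (scale, block), by W14's `coords_injective`. [folklore] -/
theorem hmult_X (K : ℕ) : ∀ (j : ℕ) (x : Fin 4 → ℕ),
    ((BX K).births.filter fun b => (BX K).birthScale b = j ∧ x ∈ (anchX K).dom b).card ≤ 1 := by
  intro j x
  refine card_le_one.mpr fun f hf f' hf' => ?_
  obtain ⟨hs, hd⟩ := (mem_filter.mp hf).2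
  obtain ⟨hs', hd'⟩ := (mem_filter.mp hf').2
  have e : x = coords f.2 := Finset.mem_singleton.mp hd
  have e' : x = coords f'.2 := Finset.mem_singleton.mp hd'
  have h1 : f.1 = f'.1 := Fin.ext (hs.trans hs'.symm)
  have h2 : f.2 = f'.2 := coords_injective (e.symm.trans e')
  exact Prod.ext h1 h2

/-- [folklore] … ATTAINED: the block `coords y` of scale `j ≤ K` carries exactly the family `(j, y)`. -/
theorem hmult_attained (K : ℕ) {j : ℕ} (hj : j ≤ K) (y : Blk 2) :
    ((BX K).births.filter fun b => (BX K).birthScale b = j ∧ coords y ∈ (anchX K).dom b).card = 1 := by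
  refine le_antisymm (hmult_X K j (coords y)) (Finset.card_pos.mpr ⟨(⟨j, Nat.lt_succ_of_le hj⟩, y), ?_⟩)
  exact mem_filter.mpr ⟨Finset.mem_univ (α := Ix K) _, rfl, Finset.mem_singleton_self _⟩

/-- `hscale`: the box of scale `k` consists of scale-`k` cubes. [folklore] -/
theorem hscale_X (K : ℕ) : ∀ k (b : (BX K).Birth), ∀ q ∈ compX K k b, (BX K).cubeScale q = k :=
  fun _ _ _ hq => (Finset.mem_filter.mp hq).2

/-- [folklore] Cubes of one scale have DISTINCT blocks (`center_inj` of S4 §3). -/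
theorem center_inj_X (K : ℕ) : ∀ q q' : (BX K).Cube, (BX K).cubeScale q = (BX K).cubeScale q' →
    (anchX K).center q = (anchX K).center q' → q = q' :=
  fun _ _ hs hc => Prod.ext (Fin.ext hs) (coords_injective hc)

/-- [folklore] The box's centres lie in the box of `ℓ = 2` blocks per side at the origin (`hbox` of S4 §3). -/
theorem hbox_X (K : ℕ) : ∀ k (b : (BX K).Birth), ∀ q ∈ compX K k b,
    (anchX K).center q ∈ Fintype.piFinset fun i : Fin 4 => Ico ((fun _ => 0) i) ((fun _ => 0) i + 2) := by
  intro k b q _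
  refine Fintype.mem_piFinset.mpr fun i => Finset.mem_Ico.mpr ⟨Nat.zero_le _, ?_⟩
  show ((q.2 i : ℕ)) < 0 + 2
  rw [Nat.zero_add]; exact (q.2 i).isLt

/-- **S4 §3's BOX COUNT FIRES** [decided toy]: `#comp ≤ ℓ^d = 2⁴` by `DressedPositionalCount.card_le_of_center_box` BY NAME — its first
applier (the R4-LOCATED collared-component form; `ℓ = 2` is the toy's, no numeral of print). [folklore] -/
theorem comp_card_le_box (K k : ℕ) (b : (BX K).Birth) : (compX K k b).card ≤ 2 ^ 4 :=
  card_le_of_center_box (anchX K) (hscale_X K k b) (center_inj_X K) (hbox_X K k b)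

/-- `hvol` at `v = 16`, THROUGH the box count. [folklore] -/
theorem hvol_X (K : ℕ) : ∀ k (b : (BX K).Birth), (compX K k b).card ≤ 16 :=
  fun k b => (comp_card_le_box K k b).trans (by norm_num)

/-- **HOUSING, GENUINE** [decided toy]: at step `k ≤ K` a live family born AT `k` is felt at its own cube of the box, one born EARLIER at the
box's corner; nothing lives above the cutoff. [folklore] -/
theorem hhoused_X (K : ℕ) : ∀ k (b : (BX K).Birth), ∀ f ∈ SX K k b, ∃ q ∈ compX K k b, f ∈ (BX K).feltAt q := by
  intro k b f hf
  unfold SX at hf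
  split_ifs at hf with hk
  · have hfk : f.1.val ≤ k := (Finset.mem_filter.mp hf).2
    rcases hfk.eq_or_lt with h | h
    · exact ⟨f, mem_boxX.mpr h, mem_feltX.mpr (Or.inl rfl)⟩
    · exact ⟨(⟨k, Nat.lt_succ_of_le hk⟩, 0), mem_boxX.mpr rfl, mem_feltX.mpr (Or.inr ⟨rfl, h⟩)⟩
  · exact absurd hf (Finset.notMem_empty _)

/-- **S4 §3's ANCHORED BOX COUNT FIRES** [decided toy]: `DressedPositionalCount.count_of_anchoring_box` BY NAME — its first applier: the live
count `≤ (ℓ^d·m)·(L^d)^(k−j) = (2⁴·1)·(2⁴)^(k−j)`. [folklore] -/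
theorem count_box_fires (K : ℕ) : ∀ k (b : (BX K).Birth), ∀ j ≤ k,
    (((SX K k b).filter fun f => (BX K).birthScale f = j).card : ℝ) ≤ (((2 ^ 4 : ℕ) : ℝ) * (1 : ℕ)) * (((2 : ℕ) : ℝ) ^ 4) ^ (k - j) :=
  count_of_anchoring_box (anchX K) two_pos (hmult_X K) (center_inj_X K) (hscale_X K) (hhoused_X K) (hbox_X K)

/-- [folklore] The box of scale `k ≤ K` IS the sixteen cubes `(k, x)`, `x ∈ {0,1}⁴`. -/
theorem boxX_eq_map (K : ℕ) {k : ℕ} (hk : k ≤ K) :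
    boxX K k = Finset.univ.map ⟨fun x : Blk 2 => ((⟨k, Nat.lt_succ_of_le hk⟩ : Fin (K + 1)), x),
      fun _ _ h => (Prod.ext_iff.mp h).2⟩ := by
  ext q
  rw [mem_boxX, Finset.mem_map]
  constructor
  · intro h; exact ⟨q.2, Finset.mem_univ _, Prod.ext (Fin.ext h.symm) rfl⟩
  · rintro ⟨x, -, rfl⟩; rfl

/-- **THE VOLUME IS ATTAINED** [decided toy]: `#comp = 16 = v` at every step `k ≤ K`. [folklore] -/
theorem comp_card_eq (K : ℕ) {k : ℕ} (hk : k ≤ K) (b : (BX K).Birth) : (compX K k b).card = 16 := by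
  show (boxX K k).card = 16
  rw [boxX_eq_map K hk, Finset.card_map, Finset.card_univ, Fintype.card_fun, Fintype.card_fin]
  norm_num

/-- `hcv`: the ℝ-step's component volume `vR = 16` (the box of the birth scale). [folklore] -/
theorem compVol_RsX (K : ℕ) : (RsX K).CompVol 16 := fun b =>
  (comp_card_eq K (Nat.lt_succ_iff.mp b.1.isLt) b).le

/-- **THE SEAM AS AN EQUALITY** [decided toy]. [folklore] -/
theorem preBelowEnv_eq (K : ℕ) (b : (BX K).Birth) (k : ℕ) :
    (RsX K).pre b (k + 1) = (((2 : ℝ) ^ 2)⁻¹ * 1) * (TX K).envVar (4 * 1 / 1) (fun _ : ℕ => ((2 : ℝ) ^ 2)⁻¹ * 1) b k := by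
  show preX K b (k + 1) = _
  unfold preX
  rw [Nat.add_sub_cancel]

/-- `hpre` — pre-sizes below the transported envelope (indeed equal; any gate). [folklore] -/
theorem preBelowEnv_RsX (K : ℕ) (Gate : ℕ → Prop) : (TX K).PreBelowEnv (RsX K) (4 * 1 / 1) (fun _ : ℕ => ((2 : ℝ) ^ 2)⁻¹ * 1) Gate :=
  fun b k _ _ _ => (preBelowEnv_eq K b k).le

/-- [folklore] Nothing is absorbed on the datum. -/
theorem absorbs_empty (K : ℕ) (b : (BX K).Birth) : (RsX K).absorbs b = ∅ := rfl

/-- `hlaw` — **THE ABSORPTION LAW WITH EQUALITY** [decided toy]: every birth is paid by the dressing alone, `4·gen = βX` (for ANY weight `A`). [folklore] -/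
theorem absorbLaw_eq (K : ℕ) (A : ℝ) (b : (BX K).Birth) :
    4 * 1 / 1 * (TX K).gen b ((BX K).birthScale b) =
      βX K ((BX K).birthScale b) + A * ∑ b₀ ∈ (RsX K).absorbs b, (RsX K).pre b₀ ((BX K).birthScale b) := by
  change 4 * 1 / 1 * (if b.1.val = b.1.val then 3 * cX K b.1.val else 0) = βX K b.1.val + A * ∑ b₀ ∈ (∅ : Finset (Ix K)), (RsX K).pre b₀ b.1.val
  rw [if_pos rfl, Finset.sum_empty, mul_zero, add_zero]
  unfold βX
  have := cX_law K b.1.val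
  norm_num at this ⊢
  linarith

/-- `hlaw` in row S3u's letters, at the weight `A = 1∕64`. [folklore] -/
theorem absorbLaw_RsX (K : ℕ) : (TX K).AbsorbLaw (RsX K) (4 * 1 / 1) (βX K) (1 / 64) := fun b => (absorbLaw_eq K _ b).le

/-- `hβ` with EQUALITY at `β₀ = 1∕32`. [folklore] -/
theorem hβ_X (K : ℕ) : ∀ j, j ≤ (BX K).K → βX K j ≤ 1 / 32 * ((2 : ℝ)⁻¹ ^ 3) ^ ((BX K).K - j) := fun _ _ => le_rfl

/-- **THE WINDOW AT BOX VOLUME** [decided toy]: `fanout (1∕64)·16·(1−½)⁻¹ = ½ < 1` and `absorbAmplitude = (1∕32)∕(1 − ½) = 1∕16 ≤ A₀ = 1∕16`. [folklore] -/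
theorem window_box : fanout (1 / 64) ((16 : ℕ) * (1 : ℕ)) (1 / 2) < 1 ∧ absorbAmplitude (1 / 32) (1 / 64) ((16 : ℕ) * (1 : ℕ)) (1 / 2) ≤ 1 / 16 := by
  unfold absorbAmplitude fanout; norm_num

/-! ## §4 THE END: row S3u §2's supplied END fires with `v = vR = 16`, `N₀ = 16` -/

/-- **THE MET COMPONENT IS A BOX ON THE COMPOSITION FACE OF RECORD** [decided toy]: `DressedStabilityStrict towerX ((2:ℝ)^4)` = row S3u §2's
`dressedStabilityStrict_of_suppliedComposition` BY NAME, ONE application, at `N₀ = 16`, `A₀ = 1∕16`, `v = vR = 16`, `mB = 1`, `A = 1∕64`,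
`β₀ = 1∕32`, window `window_box` — `hvol` supplied THROUGH S4 §3's box count. [folklore] -/
theorem suppliedBox_fires : DressedStabilityStrict towerX ((2 : ℝ) ^ 4) :=
  dressedStabilityStrict_of_suppliedComposition towerX (fun _ K => anchX K) (fun _ K => RsX K)
    (L := 2) (cδ := 1) (cbar := 0) (N₀ := 16) (A₀ := 1 / 16) (m := 1 / 2) (sbar := 0) (ρ' := 1 / 2) (θ := 1 / 4) (A := 1 / 64)
    (β₀ := 1 / 32) (mB := 1) (v := 16) (vR := 16)
    (move := fun U d t : ℂ => U + t * d) (N := fun d : ℂ => ‖d‖) (w := 1) (r := 1)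
    (moveX := fun U d t : ℂ => U + t * d) (NX := fun d : ℂ => ‖d‖)
    (G := fun _ K b k' => FnX K b k') (rel := fun _ _ _ _ U U' => U = U') (𝒦 := fun _ _ _ _ => closedBall (0 : ℂ) 1)
    (V := fun _ _ _ k' k => vmap k' k) (𝒦X := fun _ _ _ => closedBall (0 : ℂ) 1) (relX := fun _ _ _ U U' => U = U')
    (δX := fun _ _ _ => (1 : ℝ)) (c := fun _ _ _ => 0) (s₀ := fun _ _ _ _ => 0) (S := fun _ K => SX K)
    (comp := fun _ K => compX K) (β := fun _ K => βX K)
    (by norm_num) zero_le_one one_pos le_rfl (by norm_num) (by norm_num) (by norm_num)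
    (by unfold locOf; norm_num) (by norm_num) (by norm_num)
    (by norm_num) (by norm_num)
    (fun _ _ _ => zero_le_one) (fun _ _ _ => le_rfl) (fun _ _ _ => le_rfl)
    (fun _ K => hG_X K _) (fun _ K b k' => hinv_X K b k') (fun U d => by simp)
    (fun _ K => hneX_X K _) (fun _ K => hsupX_X K _)
    (fun _ _ _ => le_rfl) (fun _ _ _ _ => le_rfl) (fun _ _ _ _ => le_rfl) (fun _ K => hreg_X K _)
    (by norm_num) (fun _ K => hmult_X K) (fun _ K => hscale_X K) (fun _ K => hhoused_X K) (fun _ K => hvol_X K) (by norm_num)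
    (fun _ K => compVol_RsX K) (fun _ K => preBelowEnv_RsX K _) (by norm_num) (fun _ K => absorbLaw_RsX K) (fun _ K => hβ_X K)
    window_box.1 window_box.2
    (fun _ K => hVK_X K) (fun _ K => hVrel_X K)

/-- [folklore] The headline END (N0e `dressedStability_of_strict_comp` BY NAME) — an `example` (closed-statement dedup etiquette). -/
example : DressedStability towerX := dressedStability_of_strict_comp suppliedBox_fires

/-- [folklore] Scale-`j` indices inject into the blocks: at most sixteen of them. -/
theorem card_filter_scale_le (K j : ℕ) (T : Finset (Ix K)) : (T.filter fun b => b.1.val = j).card ≤ 16 := by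
  have h : (T.filter fun b => b.1.val = j).card ≤ (Finset.univ : Finset (Blk 2)).card := by
    refine Finset.card_le_card_of_injOn (fun b => b.2) (fun _ _ => Finset.mem_coe.mpr (Finset.mem_univ _)) ?_
    intro f hf f' hf' h
    have hs : f.1.val = j := (Finset.mem_filter.mp (Finset.mem_coe.mp hf)).2
    have hs' : f'.1.val = j := (Finset.mem_filter.mp (Finset.mem_coe.mp hf')).2
    exact Prod.ext (Fin.ext (hs.trans hs'.symm)) h
  rw [Finset.card_univ, Fintype.card_fun, Fintype.card_fin] at h
  exact h.trans (by norm_num)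

/-- **THE POSITIONAL COUNT OF THE BOOKING** at `N j k = 16·(2⁴)^(k−j)` [decided toy]: a scale-`j` fibre of a felt set has at most sixteen
members. [folklore] -/
theorem positionalCount_X (K : ℕ) : (BX K).PositionalCount fun j k => 16 * ((2 : ℝ) ^ 4) ^ (k - j) := by
  intro q j
  have h16 : ((((BX K).feltAt q).filter fun f => (BX K).birthScale f = j).card : ℝ) ≤ 16 := by
    exact_mod_cast card_filter_scale_le K j (feltX K q)
  refine h16.trans ?_
  have : (1 : ℝ) ≤ ((2 : ℝ) ^ 4) ^ ((BX K).cubeScale q - j) := one_le_pow₀ (by norm_num)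
  nlinarith

/-- **ROOT-B FIRES** [decided toy]: `DressedBudget towerX wt` for bounded nonnegative cube weights (N0e `dressedBudget_of_strict_comp` BY NAME, `N₀ = 16`). [folklore] -/
example {wt : Unit → ℕ → ℕ → ℝ} {wbar : ℝ} (hwbar : 0 ≤ wbar) (hw0 : ∀ p K, ∀ j ≤ K, 0 ≤ wt p K j)
    (hwb : ∀ p K, ∀ j ≤ K, wt p K j ≤ wbar) : DressedBudget towerX wt :=
  dressedBudget_of_strict_comp (L := 2) (N₀ := 16) suppliedBox_fires (by norm_num) hwbar hw0 hwb fun _ K => positionalCount_X K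

/-! ## §5 GENUINENESS BY THEOREM: the volume and the live count at their bounds, the window tight, W37's weight refused -/

/-- **`CompVol` IS ATTAINED** [decided toy]: the ℝ-step's component volume is NOT `≤ 15`. [folklore] -/
theorem not_compVol_fifteen (K : ℕ) : ¬ (RsX K).CompVol 15 := fun h => by
  have h16 := comp_card_eq K (Nat.zero_le K) ((⟨0, Nat.succ_pos K⟩ : Fin (K + 1)), (0 : Blk 2))
  have := h ((⟨0, Nat.succ_pos K⟩ : Fin (K + 1)), (0 : Blk 2))
  change (boxX K 0).card ≤ 15 at this
  change (boxX K 0).card = 16 at h16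
  omega

/-- **S3i's LIVE COUNT IS ATTAINED AT THE BIRTH SCALE, BY THE VOLUME** [decided toy]: at step `k ≤ K` the scale-`k` live fibre has
`16 = N₀·(2⁴)^(k−k)` members (`N₀ = v·mB = 16·1`) — and the volume-blind bound `≤ mB·Λ⁰ = 1` is FALSE. [folklore] -/
theorem live_count_top_eq (K : ℕ) {k : ℕ} (hk : k ≤ K) (b : (BX K).Birth) :
    ((SX K k b).filter fun f => (BX K).birthScale f = k).card = 16 ∧ ¬ ((SX K k b).filter fun f => (BX K).birthScale f = k).card ≤ 1 := by
  have hset : ((SX K k b).filter fun f : Ix K => f.1.val = k) = boxX K k := by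
    unfold SX; rw [if_pos hk]
    ext f
    rw [mem_boxX, Finset.mem_filter, Finset.mem_filter]
    exact ⟨fun h => h.2, fun h => ⟨⟨Finset.mem_univ _, h.le⟩, h⟩⟩
  have h16 : (boxX K k).card = 16 := comp_card_eq K hk b
  show ((SX K k b).filter fun f : Ix K => f.1.val = k).card = 16 ∧ ¬ ((SX K k b).filter fun f : Ix K => f.1.val = k).card ≤ 1
  rw [hset, h16]
  exact ⟨rfl, by omega⟩

/-- **THE WINDOW IS TIGHT** [decided toy]: the absorption amplitude EQUALS the class amplitude `A₀ = 1∕16`. [folklore] -/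
theorem window_tight : absorbAmplitude (1 / 32) (1 / 64) ((16 : ℕ) * (1 : ℕ)) (1 / 2) = 1 / 16 := by
  unfold absorbAmplitude fanout; norm_num

/-- **W37's ABSORPTION WEIGHT IS REFUSED AT BOX VOLUME** [decided toy]: `fanout ⅛·16·(1−½)⁻¹ = 4 ≮ 1` — the located DESIGN CONSTRAINT for a
box datum WITH genuine absorption (the window admits `A < 1∕32` only). [folklore] -/
theorem w37_weight_refused : ¬ fanout (1 / 8) ((16 : ℕ) * (1 : ℕ)) (1 / 2) < 1 := by
  unfold fanout; norm_num

end Summit.QuantumFields.BalabanUV.T4Continuum.NE1p.DressedSuppliedBoxWitnessEnd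

end
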